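import Summits.AnomalousDissipation.AnomalousDissipation.Theorems.MomentParityQuarticGatePairCalculus

/-!
# The explicit order-2 design: coefficient families and their averaged identities

Helper file for stub S6 (`stub_order2Design`) of the line `recession-cone` of crux
`MomentParity.QuarticGate`. The atoms of the design at viscosity `ν` and level `N` are the real
trigonometric polynomials with coefficient families (over `S = (freqBall N).erase 0`)

`ĉ(m, a, s₁, s₂) = cf + cA m + cB m ± cC ± cR a`, `(m, a, s₁, s₂) ∈ Fin 4 × FrameIdx × Bool × Bool`,

where (all families are linearly polarised two-point families `δ_k (αv) + δ_{-k} (ᾱv)`):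
`cf` = the force / mean flow `cos(2πx₁) e₀` (`k = (0,1,0)`), `cA m` = `A₁ Re(i^m e_{(0,0,1)}) e₀`,
`cB m` = `B₂ Re(-i·i^m e_{(0,1,1)}) (0,1,-1)`, `cC` = `c cos(2πN x₂) e₀` (the dissipation carrier),
`cR a` = `η ×` the Galerkin frame field `a` (the covariance noise). The families are passed as
variables with defining hypotheses (no definitions). This file proves: conjugate symmetry and
transversality of the atoms, the SUM of the atoms (`= #ι • cf`), the vanishing of the averaged
HELICITY form, the averaged CONVECTION SYMBOL (`= #ι • πA₁B₂ • cf`, the Reynolds stress of the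
correlated pair `(cA, cB)` lands exactly on the force mode), and the averaged ENERGY and ENSTROPHY.
-/

namespace Summit.AnomalousDissipation.AnomalousDissipation.Theorems.MomentParityQuarticGate

open MeasureTheory Filter Complex
open scoped InnerProductSpace ComplexConjugate
open Literature.Analysis.FunctionSpaces Literature.Analysis.FluidPDE

set_option linter.dupNamespace false

section Design

variable {N : ℕ} {A₁ B₂ c η : ℝ}
  {cf cC : (Fin 3 → ℤ) → EuclideanSpace ℂ (Fin 3)} {cA cB : Fin 4 → (Fin 3 → ℤ) → EuclideanSpace ℂ (Fin 3)}
  {cR : Torus.FrameIdx (Fin 3) N → (Fin 3 → ℤ) → EuclideanSpace ℂ (Fin 3)}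
  (hcf : cf = (Pi.single (![0, 1, 0] : Fin 3 → ℤ) (((1 / 2 : ℂ)) • EuclideanSpace.complexify (WithLp.toLp 2 ![(1 : ℝ), 0, 0] : EuclideanSpace ℝ (Fin 3))) +
        Pi.single (-(![0, 1, 0] : Fin 3 → ℤ)) ((starRingEnd ℂ) ((1 / 2 : ℂ)) • EuclideanSpace.complexify (WithLp.toLp 2 ![(1 : ℝ), 0, 0] : EuclideanSpace ℝ (Fin 3))) : (Fin 3 → ℤ) → EuclideanSpace ℂ (Fin 3)))
  (hcA : cA = fun m : Fin 4 => (Pi.single (![0, 0, 1] : Fin 3 → ℤ) ((((A₁ / 2 : ℝ) : ℂ) * Complex.I ^ (m : ℕ)) • EuclideanSpace.complexify (WithLp.toLp 2 ![(1 : ℝ), 0, 0] : EuclideanSpace ℝ (Fin 3))) +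
        Pi.single (-(![0, 0, 1] : Fin 3 → ℤ)) ((starRingEnd ℂ) (((A₁ / 2 : ℝ) : ℂ) * Complex.I ^ (m : ℕ)) • EuclideanSpace.complexify (WithLp.toLp 2 ![(1 : ℝ), 0, 0] : EuclideanSpace ℝ (Fin 3))) : (Fin 3 → ℤ) → EuclideanSpace ℂ (Fin 3)))
  (hcB : cB = fun m : Fin 4 => (Pi.single (![0, 1, 1] : Fin 3 → ℤ) ((((B₂ / 2 : ℝ) : ℂ) * -Complex.I * Complex.I ^ (m : ℕ)) • EuclideanSpace.complexify (WithLp.toLp 2 ![(0 : ℝ), 1, -1] : EuclideanSpace ℝ (Fin 3))) +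
        Pi.single (-(![0, 1, 1] : Fin 3 → ℤ)) ((starRingEnd ℂ) (((B₂ / 2 : ℝ) : ℂ) * -Complex.I * Complex.I ^ (m : ℕ)) • EuclideanSpace.complexify (WithLp.toLp 2 ![(0 : ℝ), 1, -1] : EuclideanSpace ℝ (Fin 3))) : (Fin 3 → ℤ) → EuclideanSpace ℂ (Fin 3)))
  (hcC : cC = (Pi.single (![0, 0, (N : ℤ)] : Fin 3 → ℤ) ((((c / 2 : ℝ) : ℂ)) • EuclideanSpace.complexify (WithLp.toLp 2 ![(1 : ℝ), 0, 0] : EuclideanSpace ℝ (Fin 3))) +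
        Pi.single (-(![0, 0, (N : ℤ)] : Fin 3 → ℤ)) ((starRingEnd ℂ) (((c / 2 : ℝ) : ℂ)) • EuclideanSpace.complexify (WithLp.toLp 2 ![(1 : ℝ), 0, 0] : EuclideanSpace ℝ (Fin 3))) : (Fin 3 → ℤ) → EuclideanSpace ℂ (Fin 3)))
  (hcR : cR = fun a : Torus.FrameIdx (Fin 3) N => (Pi.single (a.1 : Fin 3 → ℤ) ((((η / 2 : ℝ) : ℂ) * (if a.2.2 then (1 : ℂ) else -Complex.I)) • EuclideanSpace.complexify (Torus.perpVec (a.1 : Fin 3 → ℤ) a.2.1)) +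
        Pi.single (-(a.1 : Fin 3 → ℤ)) ((starRingEnd ℂ) (((η / 2 : ℝ) : ℂ) * (if a.2.2 then (1 : ℂ) else -Complex.I)) • EuclideanSpace.complexify (Torus.perpVec (a.1 : Fin 3 → ℤ) a.2.1)) : (Fin 3 → ℤ) → EuclideanSpace ℂ (Fin 3)))

/-! ## Frequencies of the design -/

/-- The design frequencies `(0,1,0), (0,0,1), (0,1,1)` are non-zero and pairwise not opposite or
equal. [folklore] -/
theorem design_freq_facts :
    (![0, 1, 0] : Fin 3 → ℤ) ≠ 0 ∧ (![0, 0, 1] : Fin 3 → ℤ) ≠ 0 ∧ (![0, 1, 1] : Fin 3 → ℤ) ≠ 0 ∧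
      (![0, 0, 1] : Fin 3 → ℤ) ≠ (![0, 1, 0] : Fin 3 → ℤ) ∧ (![0, 0, 1] : Fin 3 → ℤ) ≠ -(![0, 1, 0] : Fin 3 → ℤ) ∧
      (![0, 1, 1] : Fin 3 → ℤ) ≠ (![0, 1, 0] : Fin 3 → ℤ) ∧ (![0, 1, 1] : Fin 3 → ℤ) ≠ -(![0, 1, 0] : Fin 3 → ℤ) ∧
      (![0, 1, 1] : Fin 3 → ℤ) ≠ (![0, 0, 1] : Fin 3 → ℤ) ∧ (![0, 1, 1] : Fin 3 → ℤ) ≠ -(![0, 0, 1] : Fin 3 → ℤ) ∧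
      (![0, 1, 1] : Fin 3 → ℤ) + -(![0, 0, 1] : Fin 3 → ℤ) = (![0, 1, 0] : Fin 3 → ℤ) ∧ -(![0, 1, 1] : Fin 3 → ℤ) + (![0, 0, 1] : Fin 3 → ℤ) = -(![0, 1, 0] : Fin 3 → ℤ) := by
  refine ⟨?_, ?_, ?_, ?_, ?_, ?_, ?_, ?_, ?_, ?_, ?_⟩ <;> decide

/-- Squared lengths of the design frequencies: `1, 1, 2`, and `N²` for `(0,0,N)`. [folklore] -/
theorem design_freqNormSq (N : ℕ) :
    Torus.freqNormSq (![0, 1, 0] : Fin 3 → ℤ) = 1 ∧ Torus.freqNormSq (![0, 0, 1] : Fin 3 → ℤ) = 1 ∧ Torus.freqNormSq (![0, 1, 1] : Fin 3 → ℤ) = 2 ∧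
      Torus.freqNormSq (![0, 0, (N : ℤ)] : Fin 3 → ℤ) = (N : ℝ) ^ 2 := by
  simp [Torus.freqNormSq, Fin.sum_univ_three]
  norm_num

/-- At level `N ≥ 2` the design frequencies lie in the punctured ball `S = (freqBall N).erase 0`.
[folklore] -/
theorem design_mem (hN : 2 ≤ N) :
    (![0, 1, 0] : Fin 3 → ℤ) ∈ ((Torus.freqBall N).erase 0) ∧ -(![0, 1, 0] : Fin 3 → ℤ) ∈ ((Torus.freqBall N).erase 0) ∧
      (![0, 0, 1] : Fin 3 → ℤ) ∈ ((Torus.freqBall N).erase 0) ∧ -(![0, 0, 1] : Fin 3 → ℤ) ∈ ((Torus.freqBall N).erase 0) ∧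
      (![0, 1, 1] : Fin 3 → ℤ) ∈ ((Torus.freqBall N).erase 0) ∧ -(![0, 1, 1] : Fin 3 → ℤ) ∈ ((Torus.freqBall N).erase 0) ∧
      (![0, 0, (N : ℤ)] : Fin 3 → ℤ) ∈ ((Torus.freqBall N).erase 0) ∧ -(![0, 0, (N : ℤ)] : Fin 3 → ℤ) ∈ ((Torus.freqBall N).erase 0) := by
  obtain ⟨hF0, hA0, hB0, -⟩ := design_freq_facts
  obtain ⟨hF, hA, hB, hC⟩ := design_freqNormSq N
  have hN' : (2 : ℝ) ≤ N := by exact_mod_cast hN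
  have hN2 : (2 : ℝ) ≤ (N : ℝ) ^ 2 := by nlinarith
  have hC0 : (![0, 0, (N : ℤ)] : Fin 3 → ℤ) ≠ 0 := fun h => by
    have := congrFun h 2
    simp at this
    omega
  have mem : ∀ k : Fin 3 → ℤ, k ≠ 0 → Torus.freqNormSq k ≤ (N : ℝ) ^ 2 →
      k ∈ ((Torus.freqBall N).erase 0) ∧ -k ∈ ((Torus.freqBall N).erase 0) := fun k hk hle =>
    ⟨Finset.mem_erase.2 ⟨hk, Torus.mem_freqBall.2 hle⟩,
      neg_mem_freqBall_erase_zero _ (Finset.mem_erase.2 ⟨hk, Torus.mem_freqBall.2 hle⟩)⟩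
  obtain ⟨h1, h2⟩ := mem _ hF0 (by rw [hF]; linarith)
  obtain ⟨h3, h4⟩ := mem _ hA0 (by rw [hA]; linarith)
  obtain ⟨h5, h6⟩ := mem _ hB0 (by rw [hB]; exact hN2)
  obtain ⟨h7, h8⟩ := mem _ hC0 (by rw [hC])
  exact ⟨h1, h2, h3, h4, h5, h6, h7, h8⟩

/-- Dot products of the design amplitudes with the design frequencies. [folklore] -/
theorem design_dots (N : ℕ) :
    (∑ j, (WithLp.toLp 2 ![(1 : ℝ), 0, 0] : EuclideanSpace ℝ (Fin 3)) j * (((![0, 1, 0] : Fin 3 → ℤ) j : ℤ) : ℝ) = 0) ∧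
      (∑ j, (WithLp.toLp 2 ![(1 : ℝ), 0, 0] : EuclideanSpace ℝ (Fin 3)) j * (((![0, 0, 1] : Fin 3 → ℤ) j : ℤ) : ℝ) = 0) ∧
      (∑ j, (WithLp.toLp 2 ![(1 : ℝ), 0, 0] : EuclideanSpace ℝ (Fin 3)) j * (((![0, 1, 1] : Fin 3 → ℤ) j : ℤ) : ℝ) = 0) ∧
      (∑ j, (WithLp.toLp 2 ![(1 : ℝ), 0, 0] : EuclideanSpace ℝ (Fin 3)) j * (((![0, 0, (N : ℤ)] : Fin 3 → ℤ) j : ℤ) : ℝ) = 0) ∧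
      (∑ j, (WithLp.toLp 2 ![(0 : ℝ), 1, -1] : EuclideanSpace ℝ (Fin 3)) j * (((![0, 1, 1] : Fin 3 → ℤ) j : ℤ) : ℝ) = 0) := by
  simp [Fin.sum_univ_three]

/-- The frame amplitude is orthogonal to its frequency: `perpVec k j · k = 0` (`k ≠ 0`). [folklore] -/
theorem sum_perpVec_mul {k : Fin 3 → ℤ} (hk : k ≠ 0) (j : Fin 3) :
    ∑ i, Torus.perpVec k j i * ((k i : ℤ) : ℝ) = 0 := by
  have h := Torus.sum_mul_perpVec hk j
  have h' : ∑ i, ((Torus.perpVec k j i * ((k i : ℤ) : ℝ) : ℝ) : ℂ) = 0 := by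
    rw [← h]
    refine Finset.sum_congr rfl fun i _ => ?_
    push_cast
    ring
  exact_mod_cast h'


/-! ## Conjugate symmetry and transversality of the atoms -/

include hcf hcA hcB hcC hcR in
/-- **Every atom of the design has conjugate-symmetric coefficients.** [folklore] -/
theorem design_isConjSymm (p : (Fin 4 × Torus.FrameIdx (Fin 3) N × Bool × Bool)) :
    Torus.IsConjSymm (cf + cA p.1 + cB p.1 + (if p.2.2.1 then (1 : ℝ) else -1) • cC + (if p.2.2.2 then (1 : ℝ) else -1) • cR p.2.1) := by
  subst hcf hcA hcB hcC hcR
  exact ((((isConjSymm_single_add_single _ _ _).add (isConjSymm_single_add_single _ _ _)).add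
    (isConjSymm_single_add_single _ _ _)).add ((isConjSymm_single_add_single _ _ _).real_smul _)).add
    ((isConjSymm_single_add_single _ _ _).real_smul _)

include hcf hcA hcB hcC hcR in
/-- **Every atom of the design has transversal (divergence-free) coefficients.** [folklore] -/
theorem design_isTransversal (p : (Fin 4 × Torus.FrameIdx (Fin 3) N × Bool × Bool)) :
    Torus.IsTransversal ((Torus.freqBall N).erase 0) (cf + cA p.1 + cB p.1 + (if p.2.2.1 then (1 : ℝ) else -1) • cC + (if p.2.2.2 then (1 : ℝ) else -1) • cR p.2.1) := by
  subst hcf hcA hcB hcC hcR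
  obtain ⟨hF, hA, hB, hC, hBv⟩ := design_dots N
  have comm : ∀ (v : EuclideanSpace ℝ (Fin 3)) (k : Fin 3 → ℤ), ∑ j, v j * ((k j : ℤ) : ℝ) = 0 →
      ∑ j, ((k j : ℤ) : ℝ) * v j = 0 := fun v k h => by simpa only [mul_comm] using h
  refine isTransversal_add (isTransversal_add (isTransversal_add (isTransversal_add
    (isTransversal_single_add_single _ _ (comm _ _ hF)) (isTransversal_single_add_single _ _ (comm _ _ hA)))
    (isTransversal_single_add_single _ _ (comm _ _ hBv)))
    (isTransversal_real_smul (isTransversal_single_add_single _ _ (comm _ _ hC)) _))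
    (isTransversal_real_smul (isTransversal_single_add_single _ _
      (comm _ _ (sum_perpVec_mul (Torus.ne_zero_of_mem_freqBall₀ _) _))) _)

/-! ## The sum of the atoms -/

include hcA in
/-- The `cA` modes average out over the four phases. [folklore] -/
theorem design_sum_cA : ∑ m, cA m = 0 := by
  subst hcA
  refine sum_polarised_eq_zero Finset.univ _ ?_ _
  rw [← Finset.mul_sum, sum_I_pow_fin_four, mul_zero]

include hcB in
/-- The `cB` modes average out over the four phases. [folklore] -/
theorem design_sum_cB : ∑ m, cB m = 0 := by
  subst hcB
  refine sum_polarised_eq_zero Finset.univ _ ?_ _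
  rw [← Finset.mul_sum, sum_I_pow_fin_four, mul_zero]

include hcA hcB in
/-- **The sum of the atoms is `#ι` times the force mode**: phases and signs average out. [folklore] -/
theorem design_sum_atoms :
    ∑ p : (Fin 4 × Torus.FrameIdx (Fin 3) N × Bool × Bool), (cf + cA p.1 + cB p.1 + (if p.2.2.1 then (1 : ℝ) else -1) • cC + (if p.2.2.2 then (1 : ℝ) else -1) • cR p.2.1) =
      ((Fintype.card (Fin 4 × Torus.FrameIdx (Fin 3) N × Bool × Bool) : ℕ) : ℝ) • cf := by
  have h := sum_index_atoms (A := Torus.FrameIdx (Fin 3) N) (fun m => cf + cA m + cB m) cC cR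
  rw [h, Finset.sum_add_distrib, Finset.sum_add_distrib, design_sum_cA hcA, design_sum_cB hcB, add_zero,
    add_zero, Finset.sum_const, Finset.card_univ, Fintype.card_fin, ← Nat.cast_smul_eq_nsmul ℝ, smul_smul]
  congr 1
  simp only [Fintype.card_prod, Fintype.card_bool, Fintype.card_fin]
  push_cast
  ring


/-! ## The averaged helicity form vanishes -/

include hcf hcA hcB in
/-- The helicity form vanishes on the deterministic part `cf + cA m + cB m` of every atom: the three
modes have pairwise disjoint frequency supports and each is linearly polarised. [folklore] -/
theorem design_curlForm_P (w : (Fin 3 → ℤ) → ℂ) (m : Fin 4) :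
    ∑ k ∈ ((Torus.freqBall N).erase 0), (inner ℂ ((cf + cA m + cB m) k)
      (w k • IntermittentBeltrami.curlCoeff (cf + cA m + cB m) k)).re = 0 := by
  obtain ⟨hF0, hA0, hB0, hAF, hAF', hBF, hBF', hBA, hBA', -⟩ := design_freq_facts
  obtain ⟨hadd₁, hadd₂, -, -⟩ := curlForm_biadditive ((Torus.freqBall N).erase 0) w
  rw [biadditive_apply_add_three (fun c c' : (Fin 3 → ℤ) → EuclideanSpace ℂ (Fin 3) =>
      ∑ k ∈ ((Torus.freqBall N).erase 0), (inner ℂ (c k) (w k • IntermittentBeltrami.curlCoeff c' k)).re) hadd₁ hadd₂]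
  · subst hcf hcA hcB
    rw [sum_re_inner_smul_curlCoeff_polarised, sum_re_inner_smul_curlCoeff_polarised,
      sum_re_inner_smul_curlCoeff_polarised, add_zero, add_zero]
  all_goals subst hcf hcA hcB
  · exact curlForm_eq_zero_of_disjoint w (single_add_single_disjoint hAF hAF' _ _ _ _)
  · exact curlForm_eq_zero_of_disjoint w (single_add_single_disjoint hBF hBF' _ _ _ _)
  · exact curlForm_eq_zero_of_disjoint w fun k => (single_add_single_disjoint hAF hAF' _ _ _ _ k).symm
  · exact curlForm_eq_zero_of_disjoint w (single_add_single_disjoint hBA hBA' _ _ _ _)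
  · exact curlForm_eq_zero_of_disjoint w fun k => (single_add_single_disjoint hBF hBF' _ _ _ _ k).symm
  · exact curlForm_eq_zero_of_disjoint w fun k => (single_add_single_disjoint hBA hBA' _ _ _ _ k).symm

include hcf hcA hcB hcC hcR in
/-- **The averaged HELICITY form of the design vanishes**: for every weight `w`,
`∑_atoms ∑_{k∈S} Re ⟪ĉ k, w_k • curlCoeff ĉ k⟫ = 0` (two-sign polarisation separates the
deterministic part, the dissipation carrier and the noise; each piece is killed by
`design_curlForm_P` / linear polarisation). [folklore] -/
theorem design_sum_curlForm (w : (Fin 3 → ℤ) → ℂ) :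
    ∑ p : (Fin 4 × Torus.FrameIdx (Fin 3) N × Bool × Bool), ∑ k ∈ ((Torus.freqBall N).erase 0), (inner ℂ ((cf + cA p.1 + cB p.1 + (if p.2.2.1 then (1 : ℝ) else -1) • cC + (if p.2.2.2 then (1 : ℝ) else -1) • cR p.2.1) k)
      (w k • IntermittentBeltrami.curlCoeff (cf + cA p.1 + cB p.1 + (if p.2.2.1 then (1 : ℝ) else -1) • cC + (if p.2.2.2 then (1 : ℝ) else -1) • cR p.2.1) k)).re = 0 := by
  obtain ⟨hadd₁, hadd₂, hneg₁, hneg₂⟩ := curlForm_biadditive ((Torus.freqBall N).erase 0) w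
  rw [Fintype.sum_prod_type]
  refine Finset.sum_eq_zero fun m _ => ?_
  rw [Fintype.sum_prod_type]
  refine Finset.sum_eq_zero fun a _ => ?_
  rw [Fintype.sum_prod_type]
  dsimp only
  rw [sum_sign_sign_biadditive (fun c c' : (Fin 3 → ℤ) → EuclideanSpace ℂ (Fin 3) =>
      ∑ k ∈ ((Torus.freqBall N).erase 0), (inner ℂ (c k) (w k • IntermittentBeltrami.curlCoeff c' k)).re) hadd₁ hadd₂ hneg₁ hneg₂,
    design_curlForm_P hcf hcA hcB w m]
  subst hcC hcR
  rw [sum_re_inner_smul_curlCoeff_polarised, sum_re_inner_smul_curlCoeff_polarised, add_zero, add_zero, smul_zero]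

/-! ## The averaged convection symbol -/

/-- The convection symbol is additive in its first argument over finite sums. [folklore] -/
theorem convectionCoeff_sum_left {ι : Type*} (S : Finset (Fin 3 → ℤ)) (s : Finset ι)
    (x : ι → (Fin 3 → ℤ) → EuclideanSpace ℂ (Fin 3)) (c' : (Fin 3 → ℤ) → EuclideanSpace ℂ (Fin 3)) :
    Torus.convectionCoeff S (∑ m ∈ s, x m) c' = ∑ m ∈ s, Torus.convectionCoeff S (x m) c' := by
  classical
  induction s using Finset.induction_on with
  | empty => simp
  | insert i s hi ih =>
    rw [Finset.sum_insert hi, Finset.sum_insert hi, (convectionCoeff_biadditive S).1, ih]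

include hcf hcA hcB in
/-- The deterministic part of the design has only two non-vanishing convection pairs,
`(cB m · ∇) cf` and `(cB m · ∇) cA m`; all other pairs advect along `e₀ ⊥ k'` or are self-terms of
transversal modes. [folklore] -/
theorem design_convectionCoeff_P (m : Fin 4) :
    Torus.convectionCoeff ((Torus.freqBall N).erase 0) (cf + cA m + cB m) (cf + cA m + cB m) =
      Torus.convectionCoeff ((Torus.freqBall N).erase 0) (cB m) cf + Torus.convectionCoeff ((Torus.freqBall N).erase 0) (cB m) (cA m) := by
  obtain ⟨hadd₁, hadd₂, -, -⟩ := convectionCoeff_biadditive ((Torus.freqBall N).erase 0)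
  obtain ⟨hF, hA, hB, -, hBv⟩ := design_dots N
  rw [biadditive_apply_add_three_eq_sum _ hadd₁ hadd₂]
  subst hcf hcA hcB
  rw [convectionCoeff_polarised_eq_zero _ _ _ _ _ hF, convectionCoeff_polarised_eq_zero _ _ _ _ _ hA,
    convectionCoeff_polarised_eq_zero _ _ _ _ _ hB, convectionCoeff_polarised_eq_zero _ _ _ _ _ hF,
    convectionCoeff_polarised_eq_zero _ _ _ _ _ hA, convectionCoeff_polarised_eq_zero _ _ _ _ _ hB,
    convectionCoeff_polarised_eq_zero _ _ _ _ _ hBv]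
  simp only [add_zero, zero_add]

include hcB in
/-- The pairs `(cB m · ∇) cf` average out over the four phases. [folklore] -/
theorem design_sum_convectionCoeff_B_f :
    ∑ m, Torus.convectionCoeff ((Torus.freqBall N).erase 0) (cB m) cf = 0 := by
  rw [← convectionCoeff_sum_left, design_sum_cB hcB, Torus.convectionCoeff_zero_left]


include hcf hcA hcB in
/-- **The Reynolds stress of the correlated pair lands on the force mode**:
`∑_m convectionCoeff S (cB m) (cA m) = 4πA₁B₂ • cf` (the sum-frequency part `∝ i^{2m}` averages
out, the difference-frequency part `kB - kA = kF` carries `|i^m|² = 1`). [folklore] -/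
theorem design_sum_convectionCoeff_B_A (hN : 2 ≤ N) :
    ∑ m, Torus.convectionCoeff ((Torus.freqBall N).erase 0) (cB m) (cA m) = (4 * (Real.pi * A₁ * B₂)) • cf := by
  obtain ⟨hkF, hnkF, hkA, hnkA, hkB, hnkB, -, -⟩ := design_mem hN
  obtain ⟨hF0, -, -, -, -, -, -, -, -, hsum, hdiff⟩ := design_freq_facts
  obtain ⟨hadd₁, hadd₂, -, -⟩ := convectionCoeff_biadditive ((Torus.freqBall N).erase 0)
  have hsmul₁ : ∀ (r : ℂ) (x y : (Fin 3 → ℤ) → EuclideanSpace ℂ (Fin 3)), Torus.convectionCoeff ((Torus.freqBall N).erase 0) (r • x) y =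
      r • Torus.convectionCoeff ((Torus.freqBall N).erase 0) x y := fun r x y => funext fun k => Torus.convectionCoeff_smul_left _ r x y k
  have hsmul₂ : ∀ (r : ℂ) (x y : (Fin 3 → ℤ) → EuclideanSpace ℂ (Fin 3)), Torus.convectionCoeff ((Torus.freqBall N).erase 0) x (r • y) =
      r • Torus.convectionCoeff ((Torus.freqBall N).erase 0) x y := fun r x y => funext fun k => Torus.convectionCoeff_smul_right _ r x y k
  subst hcf hcA hcB
  set xe : EuclideanSpace ℂ (Fin 3) := EuclideanSpace.complexify (WithLp.toLp 2 ![(1 : ℝ), 0, 0] : EuclideanSpace ℝ (Fin 3)) with hxe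
  set xb : EuclideanSpace ℂ (Fin 3) := EuclideanSpace.complexify (WithLp.toLp 2 ![(0 : ℝ), 1, -1] : EuclideanSpace ℝ (Fin 3)) with hxb
  set α : Fin 4 → ℂ := fun m => ((A₁ / 2 : ℝ) : ℂ) * Complex.I ^ (m : ℕ) with hα
  set β : Fin 4 → ℂ := fun m => ((B₂ / 2 : ℝ) : ℂ) * -Complex.I * Complex.I ^ (m : ℕ) with hβ
  have hexp : ∀ m : Fin 4,
      Torus.convectionCoeff ((Torus.freqBall N).erase 0)
        (Pi.single (![0, 1, 1] : Fin 3 → ℤ) (β m • xb) + Pi.single (-(![0, 1, 1] : Fin 3 → ℤ)) ((starRingEnd ℂ) (β m) • xb) : (Fin 3 → ℤ) → EuclideanSpace ℂ (Fin 3))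
        (Pi.single (![0, 0, 1] : Fin 3 → ℤ) (α m • xe) + Pi.single (-(![0, 0, 1] : Fin 3 → ℤ)) ((starRingEnd ℂ) (α m) • xe) : (Fin 3 → ℤ) → EuclideanSpace ℂ (Fin 3)) =
      (β m * α m) • Torus.convectionCoeff ((Torus.freqBall N).erase 0) (Pi.single (![0, 1, 1] : Fin 3 → ℤ) xb : (Fin 3 → ℤ) → EuclideanSpace ℂ (Fin 3)) (Pi.single (![0, 0, 1] : Fin 3 → ℤ) xe : (Fin 3 → ℤ) → EuclideanSpace ℂ (Fin 3)) +
        (β m * conj (α m)) • Torus.convectionCoeff ((Torus.freqBall N).erase 0) (Pi.single (![0, 1, 1] : Fin 3 → ℤ) xb : (Fin 3 → ℤ) → EuclideanSpace ℂ (Fin 3)) (Pi.single (-(![0, 0, 1] : Fin 3 → ℤ)) xe : (Fin 3 → ℤ) → EuclideanSpace ℂ (Fin 3)) +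
        ((conj (β m) * α m) • Torus.convectionCoeff ((Torus.freqBall N).erase 0) (Pi.single (-(![0, 1, 1] : Fin 3 → ℤ)) xb : (Fin 3 → ℤ) → EuclideanSpace ℂ (Fin 3)) (Pi.single (![0, 0, 1] : Fin 3 → ℤ) xe : (Fin 3 → ℤ) → EuclideanSpace ℂ (Fin 3)) +
        (conj (β m) * conj (α m)) • Torus.convectionCoeff ((Torus.freqBall N).erase 0) (Pi.single (-(![0, 1, 1] : Fin 3 → ℤ)) xb : (Fin 3 → ℤ) → EuclideanSpace ℂ (Fin 3)) (Pi.single (-(![0, 0, 1] : Fin 3 → ℤ)) xe : (Fin 3 → ℤ) → EuclideanSpace ℂ (Fin 3))) := by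
    intro m
    rw [Pi.single_smul', Pi.single_smul', Pi.single_smul', Pi.single_smul', hadd₁, hadd₂, hadd₂]
    simp only [hsmul₁, hsmul₂, smul_smul]
  have h1 : ∑ m, β m * α m = 0 := by
    have : ∀ m, β m * α m = (((A₁ / 2 : ℝ) : ℂ) * ((B₂ / 2 : ℝ) : ℂ) * -Complex.I) *
        (Complex.I ^ (m : ℕ) * Complex.I ^ (m : ℕ)) := fun m => by simp only [hα, hβ]; ring
    simp_rw [this]
    rw [← Finset.mul_sum, sum_I_pow_mul_I_pow_fin_four, mul_zero]
  have h2 : ∑ m, β m * conj (α m) = -Complex.I * A₁ * B₂ := by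
    have : ∀ m, β m * conj (α m) = (((A₁ / 2 : ℝ) : ℂ) * ((B₂ / 2 : ℝ) : ℂ) * -Complex.I) *
        (Complex.I ^ (m : ℕ) * conj (Complex.I ^ (m : ℕ))) := fun m => by
      simp only [hα, hβ, map_mul, Complex.conj_ofReal]; ring
    simp_rw [this, I_pow_mul_conj_I_pow]
    simp only [Finset.sum_const, Finset.card_univ, Fintype.card_fin, nsmul_eq_mul]
    push_cast
    ring
  have h3 : ∑ m, conj (β m) * α m = Complex.I * A₁ * B₂ := by
    have : ∀ m, conj (β m) * α m = (((A₁ / 2 : ℝ) : ℂ) * ((B₂ / 2 : ℝ) : ℂ) * Complex.I) *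
        (conj (Complex.I ^ (m : ℕ)) * Complex.I ^ (m : ℕ)) := fun m => by
      simp only [hα, hβ, map_mul, Complex.conj_ofReal, map_neg, Complex.conj_I]; ring
    simp_rw [this, conj_I_pow_mul_I_pow]
    simp only [Finset.sum_const, Finset.card_univ, Fintype.card_fin, nsmul_eq_mul]
    push_cast
    ring
  have h4 : ∑ m, conj (β m) * conj (α m) = 0 := by
    have : ∀ m, conj (β m) * conj (α m) = (((A₁ / 2 : ℝ) : ℂ) * ((B₂ / 2 : ℝ) : ℂ) * Complex.I) *
        (conj (Complex.I ^ (m : ℕ)) * conj (Complex.I ^ (m : ℕ))) := fun m => by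
      simp only [hα, hβ, map_mul, Complex.conj_ofReal, map_neg, Complex.conj_I]; ring
    simp_rw [this]
    rw [← Finset.mul_sum, sum_conj_I_pow_mul_conj_I_pow_fin_four, mul_zero]
  -- the two surviving elementary pairs
  have hdot₂ : ∑ j, xb j * ((-(![0, 0, 1] : Fin 3 → ℤ)) j : ℂ) = 1 := by
    simp [hxb, Fin.sum_univ_three]
  have hdot₃ : ∑ j, xb j * (((![0, 0, 1] : Fin 3 → ℤ)) j : ℂ) = -1 := by
    simp [hxb, Fin.sum_univ_three]
  have hT₂v : Torus.convectionCoeff ((Torus.freqBall N).erase 0) (Pi.single (![0, 1, 1] : Fin 3 → ℤ) xb : (Fin 3 → ℤ) → EuclideanSpace ℂ (Fin 3)) (Pi.single (-(![0, 0, 1] : Fin 3 → ℤ)) xe : (Fin 3 → ℤ) → EuclideanSpace ℂ (Fin 3)) = Pi.single (![0, 1, 0] : Fin 3 → ℤ) ((2 * Real.pi * Complex.I) • xe) := by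
    funext κ
    rw [convectionCoeff_single_single hkB hnkA, hdot₂, mul_one, hsum, Pi.single_apply]
    split_ifs with h1 h2 h2 <;> first | rfl | exact absurd h1.symm h2 | exact absurd h2.symm h1
  have hT₃v : Torus.convectionCoeff ((Torus.freqBall N).erase 0) (Pi.single (-(![0, 1, 1] : Fin 3 → ℤ)) xb : (Fin 3 → ℤ) → EuclideanSpace ℂ (Fin 3)) (Pi.single (![0, 0, 1] : Fin 3 → ℤ) xe : (Fin 3 → ℤ) → EuclideanSpace ℂ (Fin 3)) = Pi.single (-(![0, 1, 0] : Fin 3 → ℤ)) ((-(2 * Real.pi * Complex.I)) • xe) := by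
    funext κ
    rw [convectionCoeff_single_single hnkB hkA, hdot₃, mul_neg, mul_one, hdiff, Pi.single_apply]
    split_ifs with h1 h2 h2 <;> first | rfl | exact absurd h1.symm h2 | exact absurd h2.symm h1
  -- assemble
  have e1 : -Complex.I * A₁ * B₂ * (2 * Real.pi * Complex.I) = ((4 * (Real.pi * A₁ * B₂) : ℝ) : ℂ) * (1 / 2 : ℂ) := by
    push_cast
    ring_nf
    rw [Complex.I_sq]
    ring
  have e2 : Complex.I * A₁ * B₂ * -(2 * Real.pi * Complex.I) =
      ((4 * (Real.pi * A₁ * B₂) : ℝ) : ℂ) * (starRingEnd ℂ) (1 / 2 : ℂ) := by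
    rw [map_div₀, map_one, Complex.conj_ofNat]
    push_cast
    ring_nf
    rw [Complex.I_sq]
    ring
  simp only []
  rw [Finset.sum_congr rfl fun m _ => hexp m, Finset.sum_add_distrib, Finset.sum_add_distrib,
    Finset.sum_add_distrib, ← Finset.sum_smul, ← Finset.sum_smul, ← Finset.sum_smul, ← Finset.sum_smul,
    h1, h2, h3, h4, zero_smul, zero_smul, zero_add, add_zero, hT₂v, hT₃v, ← Pi.single_smul', ← Pi.single_smul',
    smul_smul, smul_smul, e1, e2, ← Complex.coe_smul, smul_add, ← Pi.single_smul', ← Pi.single_smul', smul_smul,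
    smul_smul]

include hcf hcA hcB hcC hcR in
/-- **The averaged CONVECTION SYMBOL of the design is `#ι • πA₁B₂ • cf`**: two-sign polarisation
separates deterministic part, dissipation carrier and noise; the latter two and all deterministic
pairs but `(cB m·∇)(cf + cA m)` are transversal self/orthogonal terms, `(cB m·∇) cf` averages out
over the phases and `(cB m·∇) cA m` averages to `πA₁B₂ cf`. [folklore] -/
theorem design_sum_convectionCoeff (hN : 2 ≤ N) :
    ∑ p : (Fin 4 × Torus.FrameIdx (Fin 3) N × Bool × Bool), Torus.convectionCoeff ((Torus.freqBall N).erase 0) (cf + cA p.1 + cB p.1 + (if p.2.2.1 then (1 : ℝ) else -1) • cC + (if p.2.2.2 then (1 : ℝ) else -1) • cR p.2.1) (cf + cA p.1 + cB p.1 + (if p.2.2.1 then (1 : ℝ) else -1) • cC + (if p.2.2.2 then (1 : ℝ) else -1) • cR p.2.1) =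
      (((Fintype.card (Fin 4 × Torus.FrameIdx (Fin 3) N × Bool × Bool) : ℕ) : ℝ) * (Real.pi * A₁ * B₂)) • cf := by
  obtain ⟨hadd₁, hadd₂, hneg₁, hneg₂⟩ := convectionCoeff_biadditive ((Torus.freqBall N).erase 0)
  obtain ⟨-, -, -, hC, -⟩ := design_dots N
  have hQ : Torus.convectionCoeff ((Torus.freqBall N).erase 0) cC cC = 0 := by
    subst hcC; exact convectionCoeff_polarised_eq_zero _ _ _ _ _ hC
  have hR : ∀ a, Torus.convectionCoeff ((Torus.freqBall N).erase 0) (cR a) (cR a) = 0 := fun a => by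
    subst hcR; exact convectionCoeff_polarised_eq_zero _ _ _ _ _ (sum_perpVec_mul (Torus.ne_zero_of_mem_freqBall₀ _) _)
  have hP : ∀ m, Torus.convectionCoeff ((Torus.freqBall N).erase 0) (cf + cA m + cB m) (cf + cA m + cB m) =
      Torus.convectionCoeff ((Torus.freqBall N).erase 0) (cB m) cf + Torus.convectionCoeff ((Torus.freqBall N).erase 0) (cB m) (cA m) :=
    design_convectionCoeff_P hcf hcA hcB
  have hinner : ∀ (m : Fin 4) (a : Torus.FrameIdx (Fin 3) N),
      ∑ s : Bool × Bool, Torus.convectionCoeff ((Torus.freqBall N).erase 0)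
        (cf + cA m + cB m + (if s.1 then (1 : ℝ) else -1) • cC + (if s.2 then (1 : ℝ) else -1) • cR a)
        (cf + cA m + cB m + (if s.1 then (1 : ℝ) else -1) • cC + (if s.2 then (1 : ℝ) else -1) • cR a) =
      4 • (Torus.convectionCoeff ((Torus.freqBall N).erase 0) (cB m) cf + Torus.convectionCoeff ((Torus.freqBall N).erase 0) (cB m) (cA m)) := by
    intro m a
    rw [Fintype.sum_prod_type, sum_sign_sign_biadditive _ hadd₁ hadd₂ hneg₁ hneg₂, hQ, hR, hP, add_zero, add_zero]
  rw [Fintype.sum_prod_type]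
  simp_rw [Fintype.sum_prod_type (f := fun q : Torus.FrameIdx (Fin 3) N × Bool × Bool =>
    Torus.convectionCoeff ((Torus.freqBall N).erase 0)
      (cf + cA _ + cB _ + (if q.2.1 then (1 : ℝ) else -1) • cC + (if q.2.2 then (1 : ℝ) else -1) • cR q.1)
      (cf + cA _ + cB _ + (if q.2.1 then (1 : ℝ) else -1) • cC + (if q.2.2 then (1 : ℝ) else -1) • cR q.1))]
  simp_rw [hinner, Finset.sum_const, Finset.card_univ, smul_add, Finset.sum_add_distrib, ← Finset.smul_sum,
    design_sum_convectionCoeff_B_f hcB, design_sum_convectionCoeff_B_A hcf hcA hcB hN, smul_zero, zero_add,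
    smul_smul, ← Nat.cast_smul_eq_nsmul ℝ, smul_smul]
  congr 1
  simp only [Fintype.card_prod, Fintype.card_bool, Fintype.card_fin]
  push_cast
  ring

end Design

/-- **Registered sub-goal `designSums_convectionCoeff_sum_left` of stub S6** (summary of this file's
bookkeeping device): the convection symbol is additive over finite sums in its first argument.
[folklore] -/
theorem designSums_convectionCoeff_sum_left : ∀ (S : Finset (Fin 3 → ℤ)) (n : ℕ) (x : Fin n → (Fin 3 → ℤ) → EuclideanSpace ℂ (Fin 3)) (c' : (Fin 3 → ℤ) → EuclideanSpace ℂ (Fin 3)), Torus.convectionCoeff S (∑ m, x m) c' = ∑ m, Torus.convectionCoeff S (x m) c' :=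
  fun S _ x c' => convectionCoeff_sum_left S Finset.univ x c'

end Summit.AnomalousDissipation.AnomalousDissipation.Theorems.MomentParityQuarticGate
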